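import Summits.CriticalPhenomena.SAWScalingLimit.Theorems.SAWDevelopingMapObservableToSLETypeLadderCarvedReductionSqueezeGateHalfBall
import HarnessLib

/-!
# The closed limit structure avoids the open upper half-balls of the windows: closed limit hexagons
# and closed cores of the spines/bodies (piece (T-A′ P5-gate) of stub T-A′
# `stub_carvedReduction_squeezeGeometry_domains`)

Crux `SAWDevelopingMap.ObservableToSLE` (stmt-CriticalPhenomena-10472), line `six-class-type-ladder`,
stub T-A′ `stub_carvedReduction_squeezeGeometry_domains`.  Landing target:
`Summits/CriticalPhenomena/SAWScalingLimit/Theorems/SAWDevelopingMapObservableToSLETypeLadderCarvedReductionSqueezeGateStructure.lean`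
(`--supports stmt-CriticalPhenomena-10472`; registered carrier `stub_carvedReduction_gateStructure`).
Sequel of `…SqueezeGateHalfBall`.

The limit bulk of the pinned carved domains is the bulk component of `(D - τ) ∩ E^sup ∖ Z₀`, with
the CLOSED LIMIT STRUCTURE `Z₀` = the closed limit hexagons `{∀ ℓ, |skewCoord ℓ (· - C i)| ≤ ϱ i}`
of both carved levels ∪ closed cores `{infDist · K ≤ m'}` of the limit spines/bodies (`m' < m`,
`m` the persistence radius: `ρ/8`, `ρ/4`) — `squeeze_limitPackage` (p141874).  Its flatness at the
gates (the open upper half-discs at `P_i` lie in the bulk) is the content of this file: in the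
exact window at `P` of radius `r` (`…SqueezeGateHalfBall`),

* `gate_closedHexagon_below` — a CLOSED persistently removed limit hexagon whose centre is a limit
  of removed pinned vertices has no point in the open upper half-ball (positive size: shrink
  towards the centre into the interior, `gate_hexagon_interior_disjoint`; size zero: the hexagon is
  its centre, `gate_not_mem_of_tendsto_removed`);
* `gate_core_below` — a point at `infDist < m` from a set whose `(m - ε)`-neighbourhoods are
  persistently removed is not in the open upper half-ball (`gate_le_dist_of_persistent`);
* `stub_carvedReduction_gateStructure` — registered packaging.
-/

noncomputable section

open scoped Topology
open Filter Set Metric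
open Literature.Probability.LatticeModels (HexVertex hexGraph hexCenter triZeta triEmbed Site)
open Literature.Probability.RandomPlanarGeometry
open Literature.Probability.RandomPlanarGeometry.SAW

namespace Summit.CriticalPhenomena.SAWScalingLimit.Theorems.ObservableToSLE.TypeLadder

open Summit.CriticalPhenomena.SAWScalingLimit.Theorems.ObservableToSLER.BridgeGate

section Gate

variable {s : ℕ → ℝ} {x : ℕ → Site 2} {U : ℕ → Set HexVertex} {q : ℕ → HexVertex} {P : ℂ} {r : ℝ}

/-- A point all of whose skew coordinates vanish is `0`. -/
theorem eq_zero_of_skewCoord_abs_le_zero {w : ℂ} (h : ∀ ℓ : Fin 3, |skewCoord ℓ w| ≤ 0) : w = 0 := by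
  have h1 := norm_le_abs_skewCoord_sum w
  have : ‖w‖ ≤ 0 := by linarith [h 0, h 1, h 2]
  exact norm_le_zero_iff.1 this

/-- **Closed persistently removed limit hexagons lie weakly below the gate line inside the window.**
Hypotheses: the exact window at `P` (radius `r`), persistence of the `ε`-shrunken hexagon about
`C` of size `ϱ ≥ 0`, and `C` a limit of pinned REMOVED vertices (the cell centres). -/
theorem gate_closedHexagon_below (hs : ∀ j, 0 < s j) (hs0 : Tendsto s atTop (𝓝 0))
    (hconv : Tendsto (fun j => (s j : ℂ) * hexCenter (((q j).1 - x j, 0) : HexVertex)) atTop (𝓝 P))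
    (hU : ∀ᶠ j in atTop, ∀ v : HexVertex,
      (s j : ℂ) * hexCenter v - (s j : ℂ) * triEmbed (x j) ∈ ball P r → (v ∈ U j ↔ v.1 1 < (q j).1 1))
    {C : ℂ} {ϱ : ℝ}
    (hper : ∀ ε > (0 : ℝ), ∀ᶠ j in atTop, ∀ v : HexVertex,
      (∀ ℓ : Fin 3, |skewCoord ℓ ((s j : ℂ) * hexCenter v - (s j : ℂ) * triEmbed (x j) - C)| ≤ ϱ - ε) → v ∈ U j)
    {t : ℕ → HexVertex} (ht : ∀ᶠ j in atTop, t j ∈ U j)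
    (hC : Tendsto (fun j => (s j : ℂ) * hexCenter (t j) - (s j : ℂ) * triEmbed (x j)) atTop (𝓝 C))
    {z : ℂ} (hzC : ∀ ℓ : Fin 3, |skewCoord ℓ (z - C)| ≤ ϱ) (hz : dist z P < r) : z.im ≤ P.im := by
  by_contra hzim
  push Not at hzim
  rcases le_or_gt ϱ 0 with hϱ | hϱ
  · -- size zero: `z = C`, a limit of removed vertices
    have hzC' : z = C := by
      have := eq_zero_of_skewCoord_abs_le_zero (w := z - C) fun ℓ => (hzC ℓ).trans hϱ
      exact sub_eq_zero.1 this
    subst hzC'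
    exact absurd (gate_not_mem_of_tendsto_removed hs hconv hU ht hC hz) (not_le.2 hzim)
  · -- positive size: shrink towards the centre into the open hexagon, staying in the half-ball
    set zn : ℕ → ℂ := fun n => z - (((1 : ℝ) / ((n : ℝ) + 2) : ℝ) : ℂ) * (z - C) with hzn
    have hlim : Tendsto zn atTop (𝓝 z) := by
      have h1 : Tendsto (fun n : ℕ => (1 : ℝ) / ((n : ℝ) + 2)) atTop (𝓝 0) := by
        have := tendsto_one_div_add_atTop_nhds_zero_nat (𝕜 := ℝ)
        have h2 : Tendsto (fun n : ℕ => n + 1) atTop atTop := tendsto_add_atTop_nat 1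
        have h3 := this.comp h2
        refine h3.congr fun n => ?_
        simp only [Function.comp_apply]; push_cast; ring_nf
      have h2 : Tendsto (fun n : ℕ => ((((1 : ℝ) / ((n : ℝ) + 2) : ℝ) : ℂ)) * (z - C)) atTop (𝓝 (((0 : ℝ) : ℂ) * (z - C))) :=
        ((Complex.continuous_ofReal.tendsto 0).comp h1).mul_const _
      have h3 := h2.const_sub z
      simp only [Complex.ofReal_zero, zero_mul, sub_zero] at h3
      refine h3.congr fun n => ?_
      simp [hzn]
    have hopen : IsOpen ({w : ℂ | P.im < w.im} ∩ ball P r) :=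
      (isOpen_lt continuous_const Complex.continuous_im).inter isOpen_ball
    have hev : ∀ᶠ n in atTop, zn n ∈ {w : ℂ | P.im < w.im} ∩ ball P r :=
      hlim.eventually (hopen.mem_nhds ⟨hzim, mem_ball.2 hz⟩)
    obtain ⟨n, hn1, hn2⟩ := hev.exists
    have hcoef0 : 0 < (1 : ℝ) / ((n : ℝ) + 2) := by positivity
    have hcoef1 : (1 : ℝ) / ((n : ℝ) + 2) < 1 := by
      rw [div_lt_one (by positivity)]; linarith [n.cast_nonneg (α := ℝ)]
    refine gate_hexagon_interior_disjoint hs hs0 hconv hU hper (z := zn n) (fun ℓ => ?_) (mem_ball.1 hn2) hn1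
    have : zn n - C = (((1 - 1 / ((n : ℝ) + 2) : ℝ)) : ℂ) * (z - C) := by
      rw [hzn]; push_cast; ring
    rw [this, skewCoord_real_mul, abs_mul, abs_of_pos (by linarith)]
    calc (1 - 1 / ((n : ℝ) + 2)) * |skewCoord ℓ (z - C)| ≤ (1 - 1 / ((n : ℝ) + 2)) * ϱ :=
          mul_le_mul_of_nonneg_left (hzC ℓ) (by linarith)
      _ < ϱ := by nlinarith

/-- **Points near a persistently removed core lie weakly below the gate line inside the window**:
if the `(m - ε)`-neighbourhoods of `K` are persistently removed, a point `z` of the window with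
`infDist z K < m` has `im z ≤ im P`. -/
theorem gate_core_below (hs : ∀ j, 0 < s j) (hs0 : Tendsto s atTop (𝓝 0))
    (hconv : Tendsto (fun j => (s j : ℂ) * hexCenter (((q j).1 - x j, 0) : HexVertex)) atTop (𝓝 P))
    (hU : ∀ᶠ j in atTop, ∀ v : HexVertex,
      (s j : ℂ) * hexCenter v - (s j : ℂ) * triEmbed (x j) ∈ ball P r → (v ∈ U j ↔ v.1 1 < (q j).1 1))
    {K : Set ℂ} {m : ℝ}
    (hper : ∀ ε > (0 : ℝ), ∀ᶠ j in atTop, ∀ v : HexVertex,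
      infDist ((s j : ℂ) * hexCenter v - (s j : ℂ) * triEmbed (x j)) K ≤ m - ε → v ∈ U j)
    {z : ℂ} (hzK : infDist z K < m) (hKne : K.Nonempty) (hz : dist z P < r) : z.im ≤ P.im := by
  by_contra hzim
  push Not at hzim
  have : m ≤ infDist z K := by
    rw [le_infDist hKne]
    intro b hb
    rw [dist_comm]
    exact gate_le_dist_of_persistent hs hs0 hconv hU hper hb hz hzim
  linarith

/-- **Registered carrier `stub_carvedReduction_gateStructure`** (crux item stmt-CriticalPhenomena-10472,
stub T-A′ `stub_carvedReduction_squeezeGeometry_domains`, piece THE LIMIT STRUCTURE AT THE GATES):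
in the exact window at `P` of radius `r`, every closed persistently removed limit hexagon whose
centre is a limit of removed pinned vertices, and every point at `infDist < m` from a set whose
`(m - ε)`-neighbourhoods are persistently removed, lies weakly below the gate line — so the closed
limit structure misses the open upper half-ball. -/
theorem stub_carvedReduction_gateStructure :
    ∀ (s : ℕ → ℝ) (x : ℕ → Site 2) (U : ℕ → Set HexVertex) (q : ℕ → HexVertex) (P : ℂ) (r : ℝ),
      (∀ j, 0 < s j) → Tendsto s atTop (𝓝 0) →
      Tendsto (fun j => (s j : ℂ) * hexCenter (((q j).1 - x j, 0) : HexVertex)) atTop (𝓝 P) →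
      (∀ᶠ j in atTop, ∀ v : HexVertex, (s j : ℂ) * hexCenter v - (s j : ℂ) * triEmbed (x j) ∈ ball P r →
        (v ∈ U j ↔ v.1 1 < (q j).1 1)) →
      (∀ (C : ℂ) (ϱ : ℝ) (t : ℕ → HexVertex),
        (∀ ε > (0 : ℝ), ∀ᶠ j in atTop, ∀ v : HexVertex,
          (∀ ℓ : Fin 3, |skewCoord ℓ ((s j : ℂ) * hexCenter v - (s j : ℂ) * triEmbed (x j) - C)| ≤ ϱ - ε) → v ∈ U j) →
        (∀ᶠ j in atTop, t j ∈ U j) →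
        Tendsto (fun j => (s j : ℂ) * hexCenter (t j) - (s j : ℂ) * triEmbed (x j)) atTop (𝓝 C) →
        ∀ z : ℂ, (∀ ℓ : Fin 3, |skewCoord ℓ (z - C)| ≤ ϱ) → dist z P < r → z.im ≤ P.im) ∧
      (∀ (K : Set ℂ) (m : ℝ), K.Nonempty →
        (∀ ε > (0 : ℝ), ∀ᶠ j in atTop, ∀ v : HexVertex,
          infDist ((s j : ℂ) * hexCenter v - (s j : ℂ) * triEmbed (x j)) K ≤ m - ε → v ∈ U j) →
        ∀ z : ℂ, infDist z K < m → dist z P < r → z.im ≤ P.im) :=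
  fun _ _ _ _ _ _ hs hs0 hconv hU =>
    ⟨fun _ _ _ hper ht hC _ hzC hz => gate_closedHexagon_below hs hs0 hconv hU hper ht hC hzC hz,
      fun _ _ hKne hper _ hzK hz => gate_core_below hs hs0 hconv hU hper hzK hKne hz⟩

end Gate

end Summit.CriticalPhenomena.SAWScalingLimit.Theorems.ObservableToSLE.TypeLadder

end
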